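import Mathlib
import HarnessLib

/-!
# The sample (Kish) effective-sample-size fraction: `1/n ≤ ESS/n ≤ 1`, and `ESS/n = 1` iff the weights are constant

HONEST FRAMING: exact (Metropolis-corrected) sampling algorithms for lattice gauge theory;
figures of merit are autocorrelation/cost numbers at stated couplings and volumes; no
continuum-physics claim.

Venture `LatticeQCDFlow` (cell pub-lqcd), topic `Exactness`; FANOUT row 19 (`su2-snf`, family C:
defect / OBC→PBC non-equilibrium MCMC).  NEW WORK of the cell (elementary finite sums), not a
published result; nothing is cited as a fact.

## Content

For a finite family of importance / Jarzynski weights `w : ι → ℝ` on `n = card ι` samples the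
reported effective sample size is the Kish estimate `ESS = (∑ w)² / ∑ w²`, and the boarded figure
is the FRACTION `essHat w = (∑ w)² / (n · ∑ w²)` (FITNESS §1 'Exactness modes', scorer A
`kish_ess`, scorer B `ess_pooled_frac`, latflow-snf `estimators.free_energy`).

* `card_mul_sum_sq_sub_sq_sum` — the variance identity
  `n ∑ wᵢ² − (∑ wᵢ)² = ½ ∑ᵢ ∑ⱼ (wᵢ − wⱼ)²`;
* `sq_sum_le_card_mul_sum_sq` — hence `(∑ w)² ≤ n ∑ w²` (Cauchy–Schwarz against the constant
  vector), i.e. `essHat w ≤ 1` (`essHat_le_one`);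
* `sq_sum_eq_card_mul_sum_sq_iff` / `essHat_eq_one_iff` — EQUALITY holds iff all weights are
  equal.  This is the mathematical content of the planted-control signature adopted for 4-d
  reweight rows (scorer token `V2:logw-constant`, R-X3w): a reweight-mode row whose log-weights
  are constant — e.g. the INVALID-3 / X-3 re-scoring that drops the Jarzynski weights — is exactly
  a row with `ESS/n = 1`, and conversely an honest row reports `ESS/n = 1` only if every work value
  coincides;
* `sum_sq_le_sq_sum` / `inv_card_le_essHat` — for NON-NEGATIVE weights `∑ w² ≤ (∑ w)²`, so
  `1/n ≤ essHat w`: one sample's worth of information is never lost by reweighting.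

Dictionary: `wᵢ = exp (−Wᵢ)` with `Wᵢ` the dimensionless protocol work of evolution `i`
(CHAIN-FORMAT `log_w = −work`); the population version of the upper bound (densities `p`, `q`)
is `Scaling.essFrac_le_one`.
-/

namespace Summit.Ventures.LatticeQCDFlow.Exactness

open Finset

variable {ι : Type*} [Fintype ι]

/-- The sample (Kish) effective-sample-size FRACTION `ESS/n = (∑ w)² / (n ∑ w²)` of a finite
family of weights (`0` by convention when `∑ w² = 0` or `ι` is empty, via division by zero). -/
noncomputable def essHat (w : ι → ℝ) : ℝ :=
  (∑ i, w i) ^ 2 / ((Fintype.card ι : ℝ) * ∑ i, w i ^ 2)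

/-- Variance identity: `n ∑ wᵢ² − (∑ wᵢ)² = ½ ∑ᵢ ∑ⱼ (wᵢ − wⱼ)²`. -/
theorem card_mul_sum_sq_sub_sq_sum (w : ι → ℝ) :
    (Fintype.card ι : ℝ) * ∑ i, w i ^ 2 - (∑ i, w i) ^ 2
      = (1 / 2) * ∑ i, ∑ j, (w i - w j) ^ 2 := by
  have inner : ∀ i, ∑ j, (w i - w j) ^ 2
      = (Fintype.card ι : ℝ) * w i ^ 2 + (∑ j, w j ^ 2) - 2 * w i * ∑ j, w j := by
    intro i
    have e : ∀ j, (w i - w j) ^ 2 = w i ^ 2 + w j ^ 2 - 2 * w i * w j := fun j => by ring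
    simp_rw [e]
    rw [Finset.sum_sub_distrib, Finset.sum_add_distrib, Finset.sum_const, Finset.card_univ,
      nsmul_eq_mul, ← Finset.mul_sum]
  simp_rw [inner]
  rw [Finset.sum_sub_distrib, Finset.sum_add_distrib, Finset.sum_const, Finset.card_univ,
    nsmul_eq_mul, ← Finset.mul_sum, ← Finset.sum_mul, ← Finset.mul_sum]
  ring

/-- The double sum of squared differences is non-negative. -/
theorem sum_sum_sq_sub_nonneg (w : ι → ℝ) : 0 ≤ ∑ i, ∑ j, (w i - w j) ^ 2 :=
  Finset.sum_nonneg fun _ _ => Finset.sum_nonneg fun _ _ => sq_nonneg _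

/-- Cauchy–Schwarz against the constant vector: `(∑ w)² ≤ n ∑ w²`. -/
theorem sq_sum_le_card_mul_sum_sq (w : ι → ℝ) :
    (∑ i, w i) ^ 2 ≤ (Fintype.card ι : ℝ) * ∑ i, w i ^ 2 := by
  have h := card_mul_sum_sq_sub_sq_sum w
  have h0 := sum_sum_sq_sub_nonneg w
  linarith

/-- Equality case: `(∑ w)² = n ∑ w²` iff all the weights are equal. -/
theorem sq_sum_eq_card_mul_sum_sq_iff (w : ι → ℝ) :
    (∑ i, w i) ^ 2 = (Fintype.card ι : ℝ) * ∑ i, w i ^ 2 ↔ ∀ i j, w i = w j := by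
  constructor
  · intro heq i j
    have h := card_mul_sum_sq_sub_sq_sum w
    have hzero : ∑ i, ∑ j, (w i - w j) ^ 2 = 0 := by linarith
    have hi : ∑ j, (w i - w j) ^ 2 = 0 := by
      have := (Finset.sum_eq_zero_iff_of_nonneg (fun i _ =>
        Finset.sum_nonneg fun j _ => sq_nonneg (w i - w j))).mp hzero i (Finset.mem_univ i)
      exact this
    have hij : (w i - w j) ^ 2 = 0 :=
      (Finset.sum_eq_zero_iff_of_nonneg (fun j _ => sq_nonneg (w i - w j))).mp hi j
        (Finset.mem_univ j)
    have : w i - w j = 0 := pow_eq_zero_iff (n := 2) (by norm_num) |>.mp hij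
    linarith
  · intro hall
    have h := card_mul_sum_sq_sub_sq_sum w
    have hzero : ∑ i, ∑ j, (w i - w j) ^ 2 = 0 := by
      refine Finset.sum_eq_zero fun i _ => Finset.sum_eq_zero fun j _ => ?_
      rw [hall i j, sub_self]; simp
    linarith

/-- `ESS/n ≤ 1`. -/
theorem essHat_le_one (w : ι → ℝ) : essHat w ≤ 1 := by
  unfold essHat
  by_cases hden : (Fintype.card ι : ℝ) * ∑ i, w i ^ 2 = 0
  · rw [hden, div_zero]; exact zero_le_one
  · have hpos : 0 < (Fintype.card ι : ℝ) * ∑ i, w i ^ 2 := by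
      have hnn : 0 ≤ (Fintype.card ι : ℝ) * ∑ i, w i ^ 2 :=
        mul_nonneg (Nat.cast_nonneg _) (Finset.sum_nonneg fun i _ => sq_nonneg _)
      exact lt_of_le_of_ne hnn (Ne.symm hden)
    rw [div_le_one hpos]
    exact sq_sum_le_card_mul_sum_sq w

/-- The X-3 / `V2:logw-constant` signature: with at least one non-zero weight, `ESS/n = 1` iff the
weights are all equal (constant log-weights). -/
theorem essHat_eq_one_iff (w : ι → ℝ) (hw : ∑ i, w i ^ 2 ≠ 0) :
    essHat w = 1 ↔ ∀ i j, w i = w j := by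
  have hcard : (Fintype.card ι : ℝ) ≠ 0 := by
    have hne : (Finset.univ : Finset ι).Nonempty := by
      by_contra hemp
      rw [Finset.not_nonempty_iff_eq_empty] at hemp
      apply hw
      rw [show (Finset.univ : Finset ι) = ∅ from hemp]
      simp
    exact_mod_cast (Finset.card_pos.mpr hne).ne'
  have hden : (Fintype.card ι : ℝ) * ∑ i, w i ^ 2 ≠ 0 := mul_ne_zero hcard hw
  unfold essHat
  rw [div_eq_one_iff_eq hden]
  exact sq_sum_eq_card_mul_sum_sq_iff w

/-- For non-negative weights, `∑ w² ≤ (∑ w)²`. -/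
theorem sum_sq_le_sq_sum (w : ι → ℝ) (hw : ∀ i, 0 ≤ w i) :
    ∑ i, w i ^ 2 ≤ (∑ i, w i) ^ 2 := by
  rw [sq, Finset.sum_mul_sum]
  refine Finset.sum_le_sum fun i _ => ?_
  rw [sq]
  calc w i * w i = ∑ j ∈ ({i} : Finset ι), w i * w j := by simp
    _ ≤ ∑ j, w i * w j :=
        Finset.sum_le_sum_of_subset_of_nonneg (Finset.subset_univ _)
          (fun j _ _ => mul_nonneg (hw i) (hw j))

/-- `1/n ≤ ESS/n` for non-negative, not identically vanishing weights: reweighting never reports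
less than one effective sample. -/
theorem inv_card_le_essHat (w : ι → ℝ) (hw : ∀ i, 0 ≤ w i) (hpos : 0 < ∑ i, w i ^ 2) :
    1 / (Fintype.card ι : ℝ) ≤ essHat w := by
  have hcard : 0 < (Fintype.card ι : ℝ) := by
    have hne : (Finset.univ : Finset ι).Nonempty := by
      by_contra hemp
      rw [Finset.not_nonempty_iff_eq_empty] at hemp
      have : ∑ i, w i ^ 2 = 0 := by
        rw [show (Finset.univ : Finset ι) = ∅ from hemp]; simp
      linarith
    exact_mod_cast Finset.card_pos.mpr hne
  unfold essHat
  rw [div_le_div_iff₀ hcard (mul_pos hcard hpos), one_mul]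
  calc (Fintype.card ι : ℝ) * ∑ i, w i ^ 2
      ≤ (Fintype.card ι : ℝ) * (∑ i, w i) ^ 2 :=
        mul_le_mul_of_nonneg_left (sum_sq_le_sq_sum w hw) hcard.le
    _ = (∑ i, w i) ^ 2 * (Fintype.card ι : ℝ) := mul_comm _ _


/-! ## The largest weight alone pins the Kish fraction: `1/(n·s) ≤ ESS/n ≤ 1/(n·s²)`

Appended 2026-08-21 (row 19 gen-2): with `s = w k / ∑ w` the SHARE of the largest weight,
`∑ w² ≥ (w k)²` gives the upper bound and `∑ w² ≤ (w k) ∑ w` the lower one.  This is the exact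
content of the 'weight-collapsed measurement' diagnosis of LEADERBOARD record r-dc345b6d2c6e
(F1, L_d 2, n_step 28; HOME/ref-repro/REPRO-F1.md, HOME/su2-snf/xcheck/REPRO-F1-row19-reply.md):
one event carries `s = 0.284` of the total weight of `n = 605`, so `ESS/n ∈ [0.0058, 0.0205]`
WHATEVER the other 604 weights are — the boarded 0.020 sits at the upper end (remaining mass spread
evenly); a table-side 'low-ESS' trigger on `s` (e.g. `s > 0.1 ⇒ ESS/n < 1/(0.01·n)`) is therefore
a one-number certificate, independent of any error model. -/

/-- A single squared weight is at most the sum of squares. -/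
theorem sq_le_sum_sq (w : ι → ℝ) (k : ι) : w k ^ 2 ≤ ∑ i, w i ^ 2 :=
  Finset.single_le_sum (f := fun i => w i ^ 2) (fun i _ => sq_nonneg (w i)) (Finset.mem_univ k)

/-- For non-negative weights bounded by `w k`, `∑ w² ≤ w k · ∑ w`. -/
theorem sum_sq_le_max_mul_sum (w : ι → ℝ) (hw : ∀ i, 0 ≤ w i) (k : ι) (hmax : ∀ i, w i ≤ w k) :
    ∑ i, w i ^ 2 ≤ w k * ∑ i, w i := by
  rw [Finset.mul_sum]
  exact Finset.sum_le_sum fun i _ => by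
    rw [sq]; exact mul_le_mul_of_nonneg_right (hmax i) (hw i)

/-- UPPER bound from one weight's share `s = w k / ∑ w`: `ESS/n ≤ 1 / (n s²)` (any `k` with
`w k > 0`; sharpest for the largest weight). -/
theorem essHat_le_inv_card_mul_sq_share (w : ι → ℝ) (hw : ∀ i, 0 ≤ w i) (k : ι)
    (hk : 0 < w k) :
    essHat w ≤ 1 / ((Fintype.card ι : ℝ) * (w k / ∑ i, w i) ^ 2) := by
  have hS : 0 < ∑ i, w i :=
    lt_of_lt_of_le hk (Finset.single_le_sum (fun i _ => hw i) (Finset.mem_univ k))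
  have hn : 0 < (Fintype.card ι : ℝ) := by exact_mod_cast Fintype.card_pos_iff.mpr ⟨k⟩
  have hwk2 : 0 < w k ^ 2 := by positivity
  have key : 1 / ((Fintype.card ι : ℝ) * (w k / ∑ i, w i) ^ 2)
      = (∑ i, w i) ^ 2 / ((Fintype.card ι : ℝ) * w k ^ 2) := by
    field_simp
  rw [key]
  unfold essHat
  exact div_le_div_of_nonneg_left (sq_nonneg _) (mul_pos hn hwk2)
    (mul_le_mul_of_nonneg_left (sq_le_sum_sq w k) hn.le)

/-- LOWER bound from the LARGEST weight's share `s = w k / ∑ w` (`w i ≤ w k` for all `i`):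
`1 / (n s) ≤ ESS/n`. -/
theorem inv_card_mul_share_le_essHat (w : ι → ℝ) (hw : ∀ i, 0 ≤ w i) (k : ι) (hk : 0 < w k)
    (hmax : ∀ i, w i ≤ w k) :
    1 / ((Fintype.card ι : ℝ) * (w k / ∑ i, w i)) ≤ essHat w := by
  have hS : 0 < ∑ i, w i :=
    lt_of_lt_of_le hk (Finset.single_le_sum (fun i _ => hw i) (Finset.mem_univ k))
  have hn : 0 < (Fintype.card ι : ℝ) := by exact_mod_cast Fintype.card_pos_iff.mpr ⟨k⟩
  have hT : 0 < ∑ i, w i ^ 2 := lt_of_lt_of_le (by positivity : 0 < w k ^ 2) (sq_le_sum_sq w k)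
  have key : 1 / ((Fintype.card ι : ℝ) * (w k / ∑ i, w i))
      = (∑ i, w i) ^ 2 / ((Fintype.card ι : ℝ) * (w k * ∑ i, w i)) := by
    field_simp
  rw [key]
  unfold essHat
  exact div_le_div_of_nonneg_left (sq_nonneg _) (mul_pos hn hT)
    (mul_le_mul_of_nonneg_left (sum_sq_le_max_mul_sum w hw k hmax) hn.le)

end Summit.Ventures.LatticeQCDFlow.Exactness
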